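/-
Copyright (c) 2026 the pub-hodgecm-mathlib formalisation cell (harness21).  Prover seat hodgecm-mathlib-K2E1-p10 (g0), Track B ∕ K2-LIT, h413 = `stmt-HodgeConjecture-24833`,
line `K2_E1_TraceFormulaBeta`, campaign «EIS-WHITTAKER-3», WAVE 2 letter «W-hWbd₃» (RE-KEY of the dealer K2E1-plan (g5) 2026-09-04T08:47:04Z: C2₃∕C3₃ → this seat), FILE C1₃-split:
ONE HOLOMORPHIC PACKAGE PER SPLIT PLACE for the finite Whittaker factor of the spherical section of `U(2,1)_{L∕L⁺}` on the window `{1 < Re s}` (★ D-W4 p858681∕p858709 packaged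
as ★ C1₃-inert p858609 `exists_entire_inertWhittakerPackage`), with a bound UNIFORM IN THE RESIDUE CARDINALITY `q`.
-/
import Summits.HodgeConjecture.HodgeConjecture.Theorems.K2E1FiniteWhittakerSplitU3Support   -- ★ D-W4 FILE D (this seat): support; brings FILES A–C (unit value, window holomorphy, trivial bound)
import HarnessLib

/-!
# K2·E1 — `K2E1LocalWhittakerPackageSplitU3` («EIS-WHITTAKER-3», letter «W-hWbd₃», FILE C1₃-split): ONE PACKAGE PER SPLIT PLACE, HOLOMORPHIC ON `{1 < Re s}`, BOUND UNIFORM IN `q` AND `ξ`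

Track B ∕ K2-LIT, crux h413 = `stmt-HodgeConjecture-24833`, route of record `HCCMUnconditional`; cell `hodgecm-mathlib`, squad K2, ENGINE E1 (campaign «EIS-WHITTAKER-3», WAVE 2).
THEOREMS ONLY (no `def`, no `instance`, no notation, no named-fact hypothesis, no `sorry`; default heartbeats); lane `--supports stmt-HodgeConjecture-24833 --as helper` (count-neutral).
GENERIC: any non-archimedean local field `F` (`= L⁺_v = L_w = L_w̄` at a split place `v = ww̄`), ANY additive Haar measure `μ`, ANY continuous `ψ₁, ψ₂ : AddChar F Circle` with conductor
exponents `m₁, m₂` (`= (ψ_w, ψ_w̄)`), ANY frequencies `ξ₁, ξ₂` (`= (ξ_w, ξ_w̄)`).  Currency of ★ D-W4 (`K2E1FiniteWhittakerSplitU3Inner` header): the ψ-twisted big-cell integral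
`W(ξ;s) = ∫_x (∫_z max(1,‖x‖,‖z‖)^{−s} ∫_y max(1,‖y‖,‖z−xy‖)^{−s} ψ₂(yξ₂) dμ dμ) ψ₁(xξ₁) dμ` (★ `K2E1GindikinKarpelevichSplitGL3` coordinates, complex exponent `s` per height factor).

THE MATHEMATICS [CasselmanShalika1980, Thm. 5.4; Casselman1980, §3 Thm. 3.1; Garrett2018, §2.8].  The N = 3 SPLIT twin of ★ C1₃-inert `exists_entire_inertWhittakerPackage` and of ★ N = 2 C1
`exists_entire_localWhittaker_unramified`: for EVERY `(ξ₁, ξ₂)` there is `W^c : ℂ → ℂ`, namely `W^c(s) := μ(𝒪)⁻³·W(ξ;s)`, with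
 (hol) `W^c` HOLOMORPHIC ON THE WINDOW `{1 < Re s}` (★ D-W4 `differentiableOn_integral_bigCell_whittaker_gl3` — NOT claimed entire, honest scope of the dealer's ruling 08:19:48Z);
 (i) `μ(𝒪)⁻³·W(ξ;s) = W^c(s)` (definitionally, every `s`);
 (unit) at frequencies of LEVEL ZERO (`ξᵢ ∈ 𝔭^{mᵢ} ∖ 𝔭^{mᵢ+1}`) and `1 < Re s`: `W^c(s) = (1 − q^{−s})²(1 − q^{−(2s−1)})` (★ `integral_bigCell_whittaker_gl3_eq`) — the unit value of W0₃ §4 (ii′);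
 (bd) for `1 < Re s`, with `σ = Re s`: `‖W^c(s)‖ ≤ g(σ)²·h(σ)`, `g(σ) = (1−q^{−σ})∕(1−q^{1−σ})`, `h(σ) = (1−q^{−(2σ−1)})∕(1−q^{−(2σ−2)})` (★ `norm_integral_bigCell_whittaker_gl3_le`), UNIFORM in
  `ξ`, `ψ`; and (bd′) UNIFORM IN `q` on `Re s ≥ σ₁ > 1`: `‖W^c(s)‖ ≤ (1 − 2^{1−σ₁})⁻²·(1 − 2^{−(2σ₁−2)})⁻¹` (§1: `q ≥ 2`, `g(σ) ≤ (1−2^{1−σ₁})⁻¹`, `h(σ) ≤ (1−2^{−(2σ₁−2)})⁻¹`) — the constant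
  the global finite part C2₃ multiplies over the split places of `S(ξ)`;
 (supp) `ξ₁ ∉ 𝔭^{m₁}` or `ξ₂ ∉ 𝔭^{m₂}` ⟹ `W^c = 0` (★ D-W4 FILE D, every `s`).
* §1 `q`-uniform majorants of the two zeta ratios on `σ ≥ σ₁ > 1` (real analysis, `q ≥ 2`); §2 HEAD **`exists_window_splitWhittakerPackage`**; §3 conductor `𝒪` reading (`‖ξᵢ‖ = 1` unit,
  `‖ξᵢ‖ > 1` vanishing).
SAT-WITNESS: nothing is quantified over a structure; the package is the explicit function `s ↦ μ(𝒪)⁻³·W(ξ;s)`.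
HONEST LABEL: HC_CM is proved only modulo the 7 printed citations (2 remaining named inputs: hLiu418 = `stmt-HodgeConjecture-24832`, h413 = `stmt-HodgeConjecture-24833`)
until rung 0 closes; this file asserts no named fact and closes no socket; count-neutral.
References: [CasselmanShalika1980] Thm. 5.4 · [Casselman1980] §3, Thm. 3.1 · [Garrett2018] §2.8 · [Tate1950] §2.5.
-/

set_option autoImplicit false
-- the mandated namespace repeats the single-problem summit's segment (`HodgeConjecture.HodgeConjecture`)
set_option linter.dupNamespace false

noncomputable section

open MeasureTheory Filter Topology Set TopologicalSpace
open scoped NNReal ENNReal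
open Literature.NumberTheory.GaloisRepresentations Literature.NumberTheory.GaloisRepresentations.IsNonarchimedeanLocalField
open Literature.NumberTheory.Automorphic Literature.NumberTheory.Automorphic.LocalFieldHaar
open Summit.HodgeConjecture.HodgeConjecture.Cruxes.HLiu418.K2LiuGKRankOneIntegral
open Summit.HodgeConjecture.HodgeConjecture.Cruxes.H413.K2E1FiniteWhittakerSplitU3
open Summit.HodgeConjecture.HodgeConjecture.Cruxes.H413.K2E1FiniteWhittakerSplitU3Support

namespace Summit.HodgeConjecture.HodgeConjecture.Cruxes.H413.K2E1LocalWhittakerPackageSplitU3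

/-! ## §1  `q`-uniform majorants of the zeta ratios on `σ ≥ σ₁ > 1` -/

/-- For `q ≥ 2` and `σ ≥ σ₁ > 1`: `(1 − q^{−σ})∕(1 − q^{1−σ}) ≤ (1 − 2^{1−σ₁})⁻¹` (numerator `≤ 1`, `q^{1−σ} ≤ 2^{1−σ} ≤ 2^{1−σ₁} < 1`). [folklore] -/
theorem zetaRatio_le_uniform {q : ℝ} (hq : 2 ≤ q) {σ₁ σ : ℝ} (hσ₁ : 1 < σ₁) (hσ : σ₁ ≤ σ) :
    (1 - q ^ (-σ)) / (1 - q ^ (1 - σ)) ≤ (1 - (2 : ℝ) ^ (1 - σ₁))⁻¹ := by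
  have hq0 : 0 < q := by linarith
  have h2 : (2 : ℝ) ^ (1 - σ₁) < 1 := Real.rpow_lt_one_of_one_lt_of_neg one_lt_two (by linarith)
  have hle : q ^ (1 - σ) ≤ (2 : ℝ) ^ (1 - σ₁) :=
    (Real.rpow_le_rpow_of_nonpos two_pos hq (by linarith)).trans (Real.rpow_le_rpow_of_exponent_le one_le_two (by linarith))
  have hden : 0 < 1 - q ^ (1 - σ) := by linarith
  have hc : 0 < 1 - (2 : ℝ) ^ (1 - σ₁) := by linarith
  rw [div_le_iff₀ hden]
  calc 1 - q ^ (-σ) ≤ 1 := by linarith [Real.rpow_nonneg hq0.le (-σ)]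
    _ = (1 - (2 : ℝ) ^ (1 - σ₁))⁻¹ * (1 - (2 : ℝ) ^ (1 - σ₁)) := (inv_mul_cancel₀ hc.ne').symm
    _ ≤ (1 - (2 : ℝ) ^ (1 - σ₁))⁻¹ * (1 - q ^ (1 - σ)) := mul_le_mul_of_nonneg_left (by linarith) (inv_nonneg.2 hc.le)

/-- For `q ≥ 2` and `σ ≥ σ₁ > 1`: `(1 − q^{−(2σ−1)})∕(1 − q^{−(2σ−2)}) ≤ (1 − 2^{−(2σ₁−2)})⁻¹`. [folklore] -/
theorem zetaRatio_two_le_uniform {q : ℝ} (hq : 2 ≤ q) {σ₁ σ : ℝ} (hσ₁ : 1 < σ₁) (hσ : σ₁ ≤ σ) :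
    (1 - q ^ (-(2 * σ - 1))) / (1 - q ^ (-(2 * σ - 2))) ≤ (1 - (2 : ℝ) ^ (-(2 * σ₁ - 2)))⁻¹ := by
  have hq0 : 0 < q := by linarith
  have h2 : (2 : ℝ) ^ (-(2 * σ₁ - 2)) < 1 := Real.rpow_lt_one_of_one_lt_of_neg one_lt_two (by linarith)
  have hle : q ^ (-(2 * σ - 2)) ≤ (2 : ℝ) ^ (-(2 * σ₁ - 2)) :=
    (Real.rpow_le_rpow_of_nonpos two_pos hq (by linarith)).trans (Real.rpow_le_rpow_of_exponent_le one_le_two (by linarith))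
  have hden : 0 < 1 - q ^ (-(2 * σ - 2)) := by linarith
  have hc : 0 < 1 - (2 : ℝ) ^ (-(2 * σ₁ - 2)) := by linarith
  rw [div_le_iff₀ hden]
  calc 1 - q ^ (-(2 * σ - 1)) ≤ 1 := by linarith [Real.rpow_nonneg hq0.le (-(2 * σ - 1))]
    _ = (1 - (2 : ℝ) ^ (-(2 * σ₁ - 2)))⁻¹ * (1 - (2 : ℝ) ^ (-(2 * σ₁ - 2))) := (inv_mul_cancel₀ hc.ne').symm
    _ ≤ (1 - (2 : ℝ) ^ (-(2 * σ₁ - 2)))⁻¹ * (1 - q ^ (-(2 * σ - 2))) := mul_le_mul_of_nonneg_left (by linarith) (inv_nonneg.2 hc.le)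

variable {F : Type*} [Field F] [ValuativeRel F] [TopologicalSpace F] [IsNonarchimedeanLocalField F]
variable [MeasurableSpace F] [BorelSpace F] (μ : Measure F) [μ.IsAddHaarMeasure]

omit [MeasurableSpace F] [BorelSpace F] in
/-- **The `q`-uniform majorant of the split scalar**: for `Re s ≥ σ₁ > 1`, `g(σ)²h(σ) ≤ (1 − 2^{1−σ₁})⁻²·(1 − 2^{−(2σ₁−2)})⁻¹` (`q = residueFieldCard F ≥ 2`). [folklore] -/
theorem splitScalar_le_uniform {σ₁ σ : ℝ} (hσ₁ : 1 < σ₁) (hσ : σ₁ ≤ σ) :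
    ((1 - (residueFieldCard F : ℝ) ^ (-σ)) / (1 - (residueFieldCard F : ℝ) ^ (1 - σ))) ^ 2 *
        ((1 - (residueFieldCard F : ℝ) ^ (-(2 * σ - 1))) / (1 - (residueFieldCard F : ℝ) ^ (-(2 * σ - 2)))) ≤
      ((1 - (2 : ℝ) ^ (1 - σ₁))⁻¹) ^ 2 * (1 - (2 : ℝ) ^ (-(2 * σ₁ - 2)))⁻¹ := by
  have hq2 : (2 : ℝ) ≤ residueFieldCard F := by exact_mod_cast (Nat.succ_le_of_lt (one_lt_residueFieldCard F) : 2 ≤ residueFieldCard F)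
  have hq1 : (1 : ℝ) < residueFieldCard F := one_lt_residueFieldCard_real
  have hA : 0 ≤ (1 - (residueFieldCard F : ℝ) ^ (-σ)) / (1 - (residueFieldCard F : ℝ) ^ (1 - σ)) :=
    div_nonneg (by linarith [Real.rpow_le_one_of_one_le_of_nonpos hq1.le (by linarith : -σ ≤ 0)])
      (by linarith [Real.rpow_lt_one_of_one_lt_of_neg hq1 (by linarith : 1 - σ < 0)])
  have hB : 0 ≤ (1 - (residueFieldCard F : ℝ) ^ (-(2 * σ - 1))) / (1 - (residueFieldCard F : ℝ) ^ (-(2 * σ - 2))) :=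
    div_nonneg (by linarith [Real.rpow_le_one_of_one_le_of_nonpos hq1.le (by linarith : -(2 * σ - 1) ≤ 0)])
      (by linarith [Real.rpow_lt_one_of_one_lt_of_neg hq1 (by linarith : -(2 * σ - 2) < 0)])
  exact mul_le_mul (pow_le_pow_left₀ hA (zetaRatio_le_uniform hq2 hσ₁ hσ) 2) (zetaRatio_two_le_uniform hq2 hσ₁ hσ) hB (sq_nonneg _)

/-! ## §2  THE SPLIT-PLACE PACKAGE -/

/-- **THE SPLIT WHITTAKER FACTOR AS A HOLOMORPHIC PACKAGE ON THE WINDOW, UNIFORM IN THE FREQUENCY** (`ψ₁, ψ₂` continuous of conductor exponents `m₁, m₂`, Haar `μ`, ANY `ξ₁, ξ₂`).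
There is `W^c : ℂ → ℂ` (`:= s ↦ μ(𝒪)⁻³·W(ξ;s)`) with: (hol) `W^c` holomorphic on `{1 < Re s}`; (i) `μ(𝒪)⁻³·W(ξ;s) = W^c(s)` for every `s`; (unit) if `ξᵢ ∈ 𝔭^{mᵢ} ∖ 𝔭^{mᵢ+1}` then
`W^c(s) = (1 − q^{−s})²(1 − q^{−(2s−1)})` for `1 < Re s`; (bd) `‖W^c(s)‖ ≤ g(Re s)²h(Re s)` for `1 < Re s` (the ★ untwisted split scalar, uniform in `ξ`); (bd′) `‖W^c(s)‖ ≤ (1−2^{1−σ₁})⁻²(1−2^{−(2σ₁−2)})⁻¹`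
for `Re s ≥ σ₁ > 1` (uniform in `q`, `ξ`, `ψ`); (supp) `ξ₁ ∉ 𝔭^{m₁} ∨ ξ₂ ∉ 𝔭^{m₂} ⟹ W^c = 0`.  The N = 3 split twin of ★ C1₃-inert `exists_entire_inertWhittakerPackage` (window-holomorphic instead of
entire — honest scope). [cite: CasselmanShalika1980, Thm. 5.4] [cite: Casselman1980, §3 Thm. 3.1] [cite: Garrett2018, §2.8] -/
theorem exists_window_splitWhittakerPackage {ψ₁ ψ₂ : AddChar F Circle} (hψ₁ : Continuous ψ₁) (hψ₂ : Continuous ψ₂) {m₁ m₂ : ℤ}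
    (hm₁ : ψ₁.HasConductorExp m₁) (hm₂ : ψ₂.HasConductorExp m₂) (ξ₁ ξ₂ : F) :
    ∃ Wc : ℂ → ℂ, DifferentiableOn ℂ Wc {s : ℂ | 1 < s.re} ∧
      (∀ s : ℂ, ((μ.real (primePowBall F 0) : ℂ)⁻¹) ^ 3 *
        ∫ x, (∫ z, ((max 1 (max ((normAbs F x : ℝ≥0) : ℝ) ((normAbs F z : ℝ≥0) : ℝ)) : ℝ) : ℂ) ^ (-s) *
          (∫ y, ((max 1 (max ((normAbs F y : ℝ≥0) : ℝ) ((normAbs F (z - x * y) : ℝ≥0) : ℝ)) : ℝ) : ℂ) ^ (-s) * ((ψ₂ (y * ξ₂) : Circle) : ℂ) ∂μ) ∂μ) *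
          ((ψ₁ (x * ξ₁) : Circle) : ℂ) ∂μ = Wc s) ∧
      (ξ₁ ∈ primePowBall F m₁ → ξ₁ ∉ primePowBall F (m₁ + 1) → ξ₂ ∈ primePowBall F m₂ → ξ₂ ∉ primePowBall F (m₂ + 1) →
        ∀ s : ℂ, 1 < s.re → Wc s = (1 - (residueFieldCard F : ℂ) ^ (-s)) ^ 2 * (1 - (residueFieldCard F : ℂ) ^ (-(2 * s - 1)))) ∧
      (∀ s : ℂ, 1 < s.re → ‖Wc s‖ ≤ ((1 - (residueFieldCard F : ℝ) ^ (-s.re)) / (1 - (residueFieldCard F : ℝ) ^ (1 - s.re))) ^ 2 *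
        ((1 - (residueFieldCard F : ℝ) ^ (-(2 * s.re - 1))) / (1 - (residueFieldCard F : ℝ) ^ (-(2 * s.re - 2))))) ∧
      (∀ σ₁ : ℝ, 1 < σ₁ → ∀ s : ℂ, σ₁ ≤ s.re → ‖Wc s‖ ≤ ((1 - (2 : ℝ) ^ (1 - σ₁))⁻¹) ^ 2 * (1 - (2 : ℝ) ^ (-(2 * σ₁ - 2)))⁻¹) ∧
      (ξ₁ ∉ primePowBall F m₁ ∨ ξ₂ ∉ primePowBall F m₂ → Wc = 0) := by
  have hμ0 : 0 < μ.real (primePowBall F 0) := measureReal_primePowBall_pos μ 0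
  have hμ0' : ((μ.real (primePowBall F 0) : ℝ) : ℂ) ≠ 0 := by exact_mod_cast hμ0.ne'
  -- the bound (bd) as a stand-alone fact, reused for (bd′)
  have hbd : ∀ s : ℂ, 1 < s.re → ‖((μ.real (primePowBall F 0) : ℂ)⁻¹) ^ 3 *
      ∫ x, (∫ z, ((max 1 (max ((normAbs F x : ℝ≥0) : ℝ) ((normAbs F z : ℝ≥0) : ℝ)) : ℝ) : ℂ) ^ (-s) *
        (∫ y, ((max 1 (max ((normAbs F y : ℝ≥0) : ℝ) ((normAbs F (z - x * y) : ℝ≥0) : ℝ)) : ℝ) : ℂ) ^ (-s) * ((ψ₂ (y * ξ₂) : Circle) : ℂ) ∂μ) ∂μ) *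
        ((ψ₁ (x * ξ₁) : Circle) : ℂ) ∂μ‖ ≤ ((1 - (residueFieldCard F : ℝ) ^ (-s.re)) / (1 - (residueFieldCard F : ℝ) ^ (1 - s.re))) ^ 2 *
        ((1 - (residueFieldCard F : ℝ) ^ (-(2 * s.re - 1))) / (1 - (residueFieldCard F : ℝ) ^ (-(2 * s.re - 2)))) := by
    intro s hs
    rw [norm_mul, norm_pow, norm_inv, Complex.norm_real, Real.norm_of_nonneg hμ0.le]
    calc (μ.real (primePowBall F 0))⁻¹ ^ 3 * ‖∫ x, (∫ z, ((max 1 (max ((normAbs F x : ℝ≥0) : ℝ) ((normAbs F z : ℝ≥0) : ℝ)) : ℝ) : ℂ) ^ (-s) *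
          (∫ y, ((max 1 (max ((normAbs F y : ℝ≥0) : ℝ) ((normAbs F (z - x * y) : ℝ≥0) : ℝ)) : ℝ) : ℂ) ^ (-s) * ((ψ₂ (y * ξ₂) : Circle) : ℂ) ∂μ) ∂μ) *
          ((ψ₁ (x * ξ₁) : Circle) : ℂ) ∂μ‖
        ≤ (μ.real (primePowBall F 0))⁻¹ ^ 3 * (μ.real (primePowBall F 0) ^ 3 *
          (((1 - (residueFieldCard F : ℝ) ^ (-s.re)) / (1 - (residueFieldCard F : ℝ) ^ (1 - s.re))) ^ 2 *
            ((1 - (residueFieldCard F : ℝ) ^ (-(2 * s.re - 1))) / (1 - (residueFieldCard F : ℝ) ^ (-(2 * s.re - 2)))))) :=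
          mul_le_mul_of_nonneg_left (norm_integral_bigCell_whittaker_gl3_le μ hψ₁ hψ₂ ξ₁ ξ₂ hs) (by positivity)
      _ = _ := by rw [← mul_assoc, ← mul_pow, inv_mul_cancel₀ hμ0.ne', one_pow, one_mul]
  refine ⟨fun s => ((μ.real (primePowBall F 0) : ℂ)⁻¹) ^ 3 *
      ∫ x, (∫ z, ((max 1 (max ((normAbs F x : ℝ≥0) : ℝ) ((normAbs F z : ℝ≥0) : ℝ)) : ℝ) : ℂ) ^ (-s) *
        (∫ y, ((max 1 (max ((normAbs F y : ℝ≥0) : ℝ) ((normAbs F (z - x * y) : ℝ≥0) : ℝ)) : ℝ) : ℂ) ^ (-s) * ((ψ₂ (y * ξ₂) : Circle) : ℂ) ∂μ) ∂μ) *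
        ((ψ₁ (x * ξ₁) : Circle) : ℂ) ∂μ,
    (differentiableOn_integral_bigCell_whittaker_gl3 μ hψ₁ hψ₂ ξ₁ ξ₂).const_mul _, fun s => rfl, fun h₁ h₁' h₂ h₂' s hs => ?_, hbd, fun σ₁ hσ₁ s hs => ?_, fun h => ?_⟩
  · simp only
    rw [integral_bigCell_whittaker_gl3_eq μ hψ₁ hψ₂ hm₁ hm₂ h₁ h₁' h₂ h₂' hs, ← mul_assoc, ← mul_pow, inv_mul_cancel₀ hμ0', one_pow, one_mul]
  · exact (hbd s (lt_of_lt_of_le hσ₁ hs)).trans (splitScalar_le_uniform hσ₁ hs)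
  · funext s
    simp only [Pi.zero_apply]
    rcases h with h | h
    · rw [integral_bigCell_whittaker_gl3_eq_zero_of_not_mem_left μ hm₁ ψ₂ h ξ₂ s, mul_zero]
    · rw [integral_bigCell_whittaker_gl3_eq_zero_of_not_mem_right μ ψ₁ hm₂ ξ₁ h s, mul_zero]

/-! ## §3  Conductor `𝒪`: the unramified split place -/

/-- **Conductor `𝒪`** (`ψ₁, ψ₂` of conductor exponent `0`, any `ξ₁, ξ₂`): the package of §2 with (unit) at `‖ξ₁‖ = ‖ξ₂‖ = 1` and (supp) `1 < ‖ξ₁‖ ∨ 1 < ‖ξ₂‖ ⟹ W^c = 0` — at almost every split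
place of the CM pair this is the whole story: `W^c = 𝟙[‖ξ_w‖ ≤ 1]𝟙[‖ξ_w̄‖ ≤ 1]·(…)` with the unit value `(1−q^{−s})²(1−q^{−(2s−1)})` on units. [cite: CasselmanShalika1980, Thm. 5.4] [cite: Casselman1980, §3 Thm. 3.1] -/
theorem exists_window_splitWhittakerPackage_of_conductor_zero {ψ₁ ψ₂ : AddChar F Circle} (hψ₁ : Continuous ψ₁) (hψ₂ : Continuous ψ₂)
    (h₁ : ψ₁.HasConductorExp 0) (h₂ : ψ₂.HasConductorExp 0) (ξ₁ ξ₂ : F) :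
    ∃ Wc : ℂ → ℂ, DifferentiableOn ℂ Wc {s : ℂ | 1 < s.re} ∧
      (∀ s : ℂ, ((μ.real (primePowBall F 0) : ℂ)⁻¹) ^ 3 *
        ∫ x, (∫ z, ((max 1 (max ((normAbs F x : ℝ≥0) : ℝ) ((normAbs F z : ℝ≥0) : ℝ)) : ℝ) : ℂ) ^ (-s) *
          (∫ y, ((max 1 (max ((normAbs F y : ℝ≥0) : ℝ) ((normAbs F (z - x * y) : ℝ≥0) : ℝ)) : ℝ) : ℂ) ^ (-s) * ((ψ₂ (y * ξ₂) : Circle) : ℂ) ∂μ) ∂μ) *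
          ((ψ₁ (x * ξ₁) : Circle) : ℂ) ∂μ = Wc s) ∧
      (normAbs F ξ₁ = 1 → normAbs F ξ₂ = 1 → ∀ s : ℂ, 1 < s.re → Wc s = (1 - (residueFieldCard F : ℂ) ^ (-s)) ^ 2 * (1 - (residueFieldCard F : ℂ) ^ (-(2 * s - 1)))) ∧
      (∀ σ₁ : ℝ, 1 < σ₁ → ∀ s : ℂ, σ₁ ≤ s.re → ‖Wc s‖ ≤ ((1 - (2 : ℝ) ^ (1 - σ₁))⁻¹) ^ 2 * (1 - (2 : ℝ) ^ (-(2 * σ₁ - 2)))⁻¹) ∧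
      (1 < normAbs F ξ₁ ∨ 1 < normAbs F ξ₂ → Wc = 0) := by
  obtain ⟨Wc, hhol, hi, hunit, -, hbd', hsupp⟩ := exists_window_splitWhittakerPackage μ hψ₁ hψ₂ h₁ h₂ ξ₁ ξ₂
  have hmem : ∀ {ξ : F}, normAbs F ξ = 1 → ξ ∈ primePowBall F 0 := fun h => by rw [mem_primePowBall_iff, h, zpow_zero]
  have hnot : ∀ {ξ : F}, normAbs F ξ = 1 → ξ ∉ primePowBall F (0 + 1) := fun h => by
    rw [mem_primePowBall_iff, h, zero_add, zpow_one, not_le]; exact inv_residueFieldCard_lt_one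
  have hout : ∀ {ξ : F}, 1 < normAbs F ξ → ξ ∉ primePowBall F 0 := fun h hξ => not_le.2 h (by rwa [mem_primePowBall_iff, zpow_zero] at hξ)
  exact ⟨Wc, hhol, hi, fun hξ₁ hξ₂ => hunit (hmem hξ₁) (hnot hξ₁) (hmem hξ₂) (hnot hξ₂), hbd',
    fun h => hsupp (h.elim (fun h => Or.inl (hout h)) (fun h => Or.inr (hout h)))⟩

end Summit.HodgeConjecture.HodgeConjecture.Cruxes.H413.K2E1LocalWhittakerPackageSplitU3

end
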